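import Literature.NumberTheory.GaloisRepresentations.PadicEmbeddingCompletion
import Literature.NumberTheory.NumberFields.CompletionLocalDegree
import Literature.IUT.LogVolume.PrincipalArithmeticDivisors
import HarnessLib

/-!
# Every place above `p` of a number field comes from a `p`-adic embedding; `p`-adic lower bounds
# for `τ a` bound `Σ_{w ∣ p} ord⁺_w(a)·log N(w)`

Companion (theorems only) of `PadicEmbeddingCompletion.lean`, which attaches to every embedding
`τ : K → ℚ̄_p` (`PadicAlgCl p`) of a number field `K` its place `v_τ = PadicEmbedding.place τ`
above `p` and proves `‖τ ·‖ = |·|_{v_τ}^{c_τ}` and the bijection "(place `v ∣ p`, continuous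
`K_v → ℚ̄_p`) ↔ embedding". Here we add the SURJECTIVITY half of the dictionary and its use for
heights (J. Neukirch, *Algebraic Number Theory*, Ch. II (8.1)–(8.3): the extensions of `|·|_p` to
`K` are the `|τ ·|`, and every `v ∣ p` arises [cite: NeukirchANT1999, Ch. II Thm. (8.1)]):

* `exists_continuous_ringHom_adicCompletion` — every completion `K_v`, `v ∣ p`, embeds
  CONTINUOUSLY into `ℚ̄_p` (with the tree's canonical `ℚ_p`-structure
  `LocalField.adicCompletionPadicAlgebra`, `K_v/ℚ_p` is finite of degree `e_v f_v`,
  `finrank_adicCompletionPadicAlgebra_eq`; an algebra map into the algebraically closed `ℚ̄_p`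
  exists and is automatically continuous, being `ℚ_p`-linear on a finite-dimensional space);
* `exists_embedding_place_eq`, `range_place_eq` — **every place `v ∣ p` is `v_τ` for some
  `τ : K → ℚ̄_p`**;
* `exists_log_norm_eq`, `ord_mul_log_le_of_le_norm`, `toNat_ord_mul_log_le_of_le_norm` —
  `log ‖τ a‖ = −c_τ·ord_{v_τ}(a)·log N(v_τ)`, and, calibrating at `a = p` (`‖τ p‖ = p⁻¹`):
  `c₀ ≤ ‖τ a‖ ⟹ ord_{v_τ}(a)·log p ≤ ord_{v_τ}(p)·log c₀⁻¹`;
* `sum_ord_natCast_mul_logNorm_le` — `Σ_{w ∈ T} ord_w(p)·log N(w) ≤ [K:ℚ]·log p` (product formula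
  for `p`, tree `sum_ord_mul_logNorm_eq_sum_mult_log`);
* `sum_toNat_ord_mul_logNorm_le_of_forall_embedding` — **if `c₀ ≤ ‖τ a‖` for every
  `τ : K → ℚ̄_p`, then `Σ_{w ∈ T} ord⁺_w(a)·log N(w) ≤ [K:ℚ]·log c₀⁻¹` for every finite set `T`
  of places above `p`.**

The last statement is the dictionary between the two languages used by the abc-iut cell's
GenEllTwo packages ([GenEll] Thm. 2.1, `Summit.ABC.ABC.Theses.IUTThetaPilot.GenEllTwo`):
separation hypotheses and lower bounds at a finite place are produced through EMBEDDINGS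
`σ : F →+* PadicAlgCl p` (the compactly-bounded-subset convention `CBData.Mem`, packages W5b/W7),
while the place-wise κ-summation (package W5d, `FibreConductorSummation`) consumes
`Σ_{w ∈ S_bad} ord⁺_w(a)·log N(w) ≤ C` in terms of the tree's `Literature.IUT.LogVolume.ord` and
`logNorm`. Nothing here is specific to that application; no definitions, no named facts.
-/

noncomputable section

open scoped NumberField
open NumberField IsDedekindDomain IsDedekindDomain.HeightOneSpectrum

namespace Literature.NumberTheory.GaloisRepresentations

namespace PadicEmbedding

variable {K : Type} [Field K] [NumberField K] {p : ℕ} [Fact p.Prime]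

/-- **Every completion `K_v` at a place `v ∣ p` embeds continuously into `ℚ̄_p`.** With the
canonical `ℚ_p`-algebra structure of `K_v` (`LocalField.adicCompletionPadicAlgebra`, under which
`K_v` is finite over `ℚ_p` of degree `e_v f_v`, Neukirch Ch. II (8.5)), any `ℚ_p`-algebra map
`K_v → ℚ̄_p` (which exists as `ℚ̄_p` is algebraically closed) is `ℚ_p`-linear on a
finite-dimensional Hausdorff topological vector space, hence continuous.
[cite: NeukirchANT1999, Ch. II Thm. (8.1)] -/
theorem exists_continuous_ringHom_adicCompletion (v : HeightOneSpectrum (𝓞 K))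
    (hv : ((p : ℕ) : 𝓞 K) ∈ v.asIdeal) :
    ∃ e : v.adicCompletion K →+* PadicAlgCl p, Continuous e := by
  letI : Algebra ℚ_[p] (v.adicCompletion K) := LocalField.adicCompletionPadicAlgebra v p hv
  have hc : Continuous (algebraMap ℚ_[p] (v.adicCompletion K)) :=
    LocalField.continuous_algebraMap_adicCompletionPadicAlgebra v p hv
  -- finite-dimensionality from `[K_v : ℚ_p] = e_v f_v > 0`
  have hfr : Module.finrank ℚ_[p] (v.adicCompletion K) =
      v.asIdeal.ramificationIdx ℤ * v.asIdeal.inertiaDeg ℤ :=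
    Literature.NumberTheory.NumberFields.finrank_adicCompletionPadicAlgebra_eq p v hv
  haveI : v.asIdeal.IsPrime := v.isPrime
  have hpos : 0 < Module.finrank ℚ_[p] (v.adicCompletion K) := by
    rw [hfr]
    exact Nat.mul_pos (Ideal.ramificationIdx_pos _ _) (Ideal.inertiaDeg_pos _ _)
  haveI : FiniteDimensional ℚ_[p] (v.adicCompletion K) := Module.finite_of_finrank_pos hpos
  haveI : Algebra.IsAlgebraic ℚ_[p] (v.adicCompletion K) := Algebra.IsAlgebraic.of_finite _ _
  let e : v.adicCompletion K →ₐ[ℚ_[p]] PadicAlgCl p := IsAlgClosed.lift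
  haveI : ContinuousSMul ℚ_[p] (v.adicCompletion K) := by
    refine ⟨?_⟩
    have : (fun q : ℚ_[p] × v.adicCompletion K => q.1 • q.2) =
        fun q => algebraMap ℚ_[p] (v.adicCompletion K) q.1 * q.2 := by
      funext q; exact Algebra.smul_def _ _
    rw [this]
    exact (hc.comp continuous_fst).mul continuous_snd
  exact ⟨e.toRingHom, e.toLinearMap.continuous_of_finiteDimensional⟩

/-- **Every place `v ∣ p` of a number field is the place of some `p`-adic embedding**
`τ : K → ℚ̄_p` (`PadicEmbedding.place τ = v`): the map "embedding ↦ place" is onto the places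
above `p` — the missing surjectivity half of the dictionary `PadicEmbedding.placeEmbEquiv`.
[cite: NeukirchANT1999, Ch. II Thm. (8.1)] -/
theorem exists_embedding_place_eq (v : HeightOneSpectrum (𝓞 K)) (hv : ((p : ℕ) : 𝓞 K) ∈ v.asIdeal) :
    ∃ τ : K →+* PadicAlgCl p, place τ = v := by
  obtain ⟨e, he⟩ := exists_continuous_ringHom_adicCompletion v hv
  exact ⟨e.comp (algebraMap K (v.adicCompletion K)), place_comp_algebraMap e he⟩

/-- The places of the `p`-adic embeddings of `K` are exactly the places above `p`.
[cite: NeukirchANT1999, Ch. II Thm. (8.1)] -/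
theorem range_place_eq :
    Set.range (place (K := K) (ℓ := p)) = {v | ((p : ℕ) : 𝓞 K) ∈ v.asIdeal} := by
  ext v
  constructor
  · rintro ⟨τ, rfl⟩
    exact natCast_mem_place τ
  · intro hv
    obtain ⟨τ, hτ⟩ := exists_embedding_place_eq v hv
    exact ⟨τ, hτ⟩

/-! ### `p`-adic size of `τ a` versus `ord_v(a)` -/

open Literature.IUT.LogVolume in
/-- **`log ‖τ a‖ = −c_τ · ord_{v_τ}(a) · log N(v_τ)`** for `a ≠ 0`, with the positive constant
`c_τ` of `exists_norm_eq_adicAbv_rpow` (`‖τ ·‖ = |·|_{v_τ}^{c_τ}`) and the tree's normalised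
valuation `ord` (`|a|_v = N(v)^{−ord_v(a)}`, `adicAbv_eq_absNorm_zpow`).
[cite: NeukirchANT1999, Ch. II Prop. (8.3)] -/
theorem exists_log_norm_eq (τ : K →+* PadicAlgCl p) :
    ∃ c : ℝ, 0 < c ∧ ∀ a : K, a ≠ 0 →
      Real.log ‖τ a‖ = -(c * (ord K (place τ) a : ℝ) * logNorm K (place τ)) := by
  obtain ⟨c, hc, h⟩ := exists_norm_eq_adicAbv_rpow τ
  refine ⟨c, hc, fun a ha => ?_⟩
  have hN : (0 : ℝ) < (Ideal.absNorm (place τ).asIdeal : ℕ) := by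
    exact_mod_cast (zero_lt_one.trans (NumberField.HeightOneSpectrum.one_lt_absNorm (place τ)))
  rw [h a, adicAbv_eq_absNorm_zpow K (place τ) ha, ← Real.rpow_intCast,
    ← Real.rpow_mul hN.le, Real.log_rpow hN, logNorm]
  push_cast
  ring

open Literature.IUT.LogVolume in
/-- **From a `p`-adic lower bound to a valuation bound.** If `c₀ ≤ ‖τ a‖` then
`ord_{v_τ}(a) · log p ≤ ord_{v_τ}(p) · log c₀⁻¹` (calibrate the constant of `exists_log_norm_eq`
at `a = p`, where `‖τ p‖ = p⁻¹`). [cite: NeukirchANT1999, Ch. II Prop. (8.3)] -/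
theorem ord_mul_log_le_of_le_norm (τ : K →+* PadicAlgCl p) {a : K} (ha : a ≠ 0) {c₀ : ℝ}
    (hc₀ : 0 < c₀) (h : c₀ ≤ ‖τ a‖) :
    (ord K (place τ) a : ℝ) * Real.log p ≤ (ord K (place τ) (p : K) : ℝ) * Real.log c₀⁻¹ := by
  obtain ⟨c, hc, hlog⟩ := exists_log_norm_eq τ
  have hp : (p : K) ≠ 0 := Nat.cast_ne_zero.mpr (Fact.out : p.Prime).ne_zero
  have hpR : (0 : ℝ) < p := Nat.cast_pos.mpr (Fact.out : p.Prime).pos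
  -- `‖τ p‖ = p⁻¹`
  have hτp : ‖τ (p : K)‖ = (p : ℝ)⁻¹ := by
    rw [map_natCast]
    have : ((p : ℕ) : PadicAlgCl p) = algebraMap ℚ_[p] (PadicAlgCl p) (p : ℚ_[p]) := by
      rw [map_natCast]
    rw [this, norm_algebraMap', Padic.norm_p]
  have h1 := hlog a ha
  have h2 := hlog (p : K) hp
  rw [hτp, Real.log_inv] at h2
  set L := logNorm K (place τ) with hL
  have hL0 : 0 < L := logNorm_pos K (place τ)
  set e := (ord K (place τ) (p : K) : ℝ) with he
  set m := (ord K (place τ) a : ℝ) with hm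
  -- `log c₀ ≤ log ‖τ a‖ = -c m L` and `log p = c e L`
  have h3 : Real.log c₀ ≤ -(c * m * L) := by
    rw [← h1]; exact Real.log_le_log hc₀ h
  have h4 : Real.log p = c * e * L := by linarith
  have he0 : 0 ≤ e := by
    have := ord_nonneg_of_isIntegral K (place τ) (p : 𝓞 K)
    rw [he]; exact_mod_cast this
  have h3' : c * m * L ≤ -Real.log c₀ := by linarith
  rw [Real.log_inv, h4]
  calc m * (c * e * L) = (c * m * L) * e := by ring
    _ ≤ (-Real.log c₀) * e := mul_le_mul_of_nonneg_right h3' he0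
    _ = e * -Real.log c₀ := by ring

open Literature.IUT.LogVolume in
/-- The same with `ord⁺ = max(ord, 0)` (`Int.toNat`), for `0 < c₀ ≤ 1`.
[cite: NeukirchANT1999, Ch. II Prop. (8.3)] -/
theorem toNat_ord_mul_log_le_of_le_norm (τ : K →+* PadicAlgCl p) {a : K} (ha : a ≠ 0) {c₀ : ℝ}
    (hc₀ : 0 < c₀) (hc₁ : c₀ ≤ 1) (h : c₀ ≤ ‖τ a‖) :
    ((ord K (place τ) a).toNat : ℝ) * Real.log p ≤
      (ord K (place τ) (p : K) : ℝ) * Real.log c₀⁻¹ := by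
  have hlog0 : 0 ≤ Real.log c₀⁻¹ := Real.log_nonneg (one_le_inv_iff₀.mpr ⟨hc₀, hc₁⟩)
  have he0 : (0 : ℝ) ≤ (ord K (place τ) (p : K) : ℝ) := by
    have := ord_nonneg_of_isIntegral K (place τ) (p : 𝓞 K)
    exact_mod_cast this
  rcases le_or_gt (ord K (place τ) a) 0 with hm | hm
  · rw [Int.toNat_of_nonpos hm]
    simp only [CharP.cast_eq_zero, zero_mul]
    exact mul_nonneg he0 hlog0
  · rw [show ((ord K (place τ) a).toNat : ℝ) = (ord K (place τ) a : ℝ) by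
      rw [← Int.toNat_of_nonneg hm.le]; push_cast; rw [Int.toNat_of_nonneg hm.le]]
    exact ord_mul_log_le_of_le_norm τ ha hc₀ h

open Literature.IUT.LogVolume in
/-- **`Σ_{v ∣ p} ord_v(p) · log N(v) = [K:ℚ] · log p`** — the finite part of the product formula
for the rational prime `p` (degree of the principal divisor of `p`), for any finite set `T` of
places containing those above `p`. [cite: NeukirchANT1999, Ch. III Prop. (1.3)] -/
theorem sum_ord_natCast_mul_logNorm_le (T : Finset (HeightOneSpectrum (𝓞 K))) :
    ∑ w ∈ T, (ord K w (p : K) : ℝ) * logNorm K w ≤ Module.finrank ℚ K * Real.log p := by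
  classical
  have hp : (p : K) ≠ 0 := Nat.cast_ne_zero.mpr (Fact.out : p.Prime).ne_zero
  set S := (finite_setOf_ord_ne_zero K (p : K)).toFinset with hS
  have hT : {v | ord K v (p : K) ≠ 0} ⊆ ((T ∪ S : Finset _) : Set _) := by
    intro v hv
    simp only [Finset.coe_union, Set.mem_union, Finset.mem_coe, hS, Set.Finite.mem_toFinset]
    exact Or.inr hv
  have hsum := sum_ord_mul_logNorm_eq_sum_mult_log hp hT
  have hnonneg : ∀ w ∈ (T ∪ S), (0 : ℝ) ≤ (ord K w (p : K) : ℝ) * logNorm K w := fun w _ =>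
    mul_nonneg (by exact_mod_cast ord_nonneg_of_isIntegral K w (p : 𝓞 K)) (logNorm_pos K w).le
  have hle : ∑ w ∈ T, (ord K w (p : K) : ℝ) * logNorm K w ≤
      ∑ w ∈ T ∪ S, (ord K w (p : K) : ℝ) * logNorm K w :=
    Finset.sum_le_sum_of_subset_of_nonneg Finset.subset_union_left fun w hw _ => hnonneg w hw
  refine hle.trans (le_of_eq ?_)
  rw [hsum]
  have hw : ∀ w : InfinitePlace K, (w.mult : ℝ) * Real.log (w (p : K)) = w.mult * Real.log p := by
    intro w
    rw [← InfinitePlace.norm_embedding_eq, map_natCast, Complex.norm_natCast]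
  rw [Finset.sum_congr rfl fun w _ => hw w, ← Finset.sum_mul]
  congr 1
  exact_mod_cast InfinitePlace.sum_mult_eq (K := K)

open Literature.IUT.LogVolume in
/-- **The bad-place term of the κ-summation from `p`-adic lower bounds.** If every `p`-adic
embedding `τ : K → ℚ̄_p` satisfies `c₀ ≤ ‖τ a‖` (`0 < c₀ ≤ 1`), then for every finite set `T`
of places of `K` above `p`,
`Σ_{w ∈ T} ord⁺_w(a) · log N(w) ≤ [K:ℚ] · log c₀⁻¹`.
This converts the embedding-language separation bounds of the abc-iut GenEllTwo packages W5b/W7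
into the `hbad` hypothesis of the place-wise summation (package W5d).
[cite: NeukirchANT1999, Ch. II Prop. (8.3)] -/
theorem sum_toNat_ord_mul_logNorm_le_of_forall_embedding {a : K} (ha : a ≠ 0) {c₀ : ℝ}
    (hc₀ : 0 < c₀) (hc₁ : c₀ ≤ 1) (h : ∀ τ : K →+* PadicAlgCl p, c₀ ≤ ‖τ a‖)
    (T : Finset (HeightOneSpectrum (𝓞 K))) (hT : ∀ w ∈ T, ((p : ℕ) : 𝓞 K) ∈ w.asIdeal) :
    ∑ w ∈ T, ((ord K w a).toNat : ℝ) * logNorm K w ≤ Module.finrank ℚ K * Real.log c₀⁻¹ := by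
  have hpR : (1 : ℝ) < p := by exact_mod_cast (Fact.out : p.Prime).one_lt
  have hlogp : 0 < Real.log p := Real.log_pos hpR
  have hlog0 : 0 ≤ Real.log c₀⁻¹ := Real.log_nonneg (one_le_inv_iff₀.mpr ⟨hc₀, hc₁⟩)
  -- termwise: `ord⁺_w(a)·log N(w) ≤ (ord_w(p)·log N(w)) · (log c₀⁻¹ / log p)`
  have hterm : ∀ w ∈ T, ((ord K w a).toNat : ℝ) * logNorm K w ≤
      (ord K w (p : K) : ℝ) * logNorm K w * (Real.log c₀⁻¹ / Real.log p) := by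
    intro w hw
    obtain ⟨τ, rfl⟩ := exists_embedding_place_eq w (hT w hw)
    have hmain := toNat_ord_mul_log_le_of_le_norm τ ha hc₀ hc₁ (h τ)
    have hL := (logNorm_pos K (place τ)).le
    have hmul := mul_le_mul_of_nonneg_right hmain (div_nonneg hL hlogp.le)
    calc ((ord K (place τ) a).toNat : ℝ) * logNorm K (place τ)
        = ((ord K (place τ) a).toNat : ℝ) * Real.log p * (logNorm K (place τ) / Real.log p) := by
          field_simp
      _ ≤ (ord K (place τ) (p : K) : ℝ) * Real.log c₀⁻¹ * (logNorm K (place τ) / Real.log p) := hmul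
      _ = (ord K (place τ) (p : K) : ℝ) * logNorm K (place τ) * (Real.log c₀⁻¹ / Real.log p) := by
          ring
  calc ∑ w ∈ T, ((ord K w a).toNat : ℝ) * logNorm K w
      ≤ ∑ w ∈ T, (ord K w (p : K) : ℝ) * logNorm K w * (Real.log c₀⁻¹ / Real.log p) :=
        Finset.sum_le_sum hterm
    _ = (∑ w ∈ T, (ord K w (p : K) : ℝ) * logNorm K w) * (Real.log c₀⁻¹ / Real.log p) := by
        rw [Finset.sum_mul]
    _ ≤ (Module.finrank ℚ K * Real.log p) * (Real.log c₀⁻¹ / Real.log p) :=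
        mul_le_mul_of_nonneg_right (sum_ord_natCast_mul_logNorm_le T)
          (div_nonneg hlog0 hlogp.le)
    _ = Module.finrank ℚ K * Real.log c₀⁻¹ := by
        field_simp

end PadicEmbedding

end Literature.NumberTheory.GaloisRepresentations

end
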